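import Mathlib
import HarnessLib
import Summits.NavierStokesRegularity.NavierStokesRegularity.Theses.SymmetryModuliCount
import Summits.NavierStokesRegularity.NavierStokesRegularity.Theorems.SymmetryModuliCountAxisymEndLiouvilleOfFarPastLedgerAssembly
import Summits.NavierStokesRegularity.NavierStokesRegularity.Theorems.SymmetryModuliCountAxisymEndLiouvilleOfFarPastLedgerPressure
import Summits.NavierStokesRegularity.NavierStokesRegularity.Theorems.SymmetryModuliCountAxisymEndLiouvilleOfFarPastLedgerCubic
import Summits.NavierStokesRegularity.NavierStokesRegularity.Theorems.SymmetryModuliCountAxisymEndLiouvilleOfFarPastLedgerDriver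
import Summits.NavierStokesRegularity.NavierStokesRegularity.Theorems.SymmetryModuliCountAxisymEndLiouvilleOfFarPastLedgerEndgame
import Summits.NavierStokesRegularity.NavierStokesRegularity.Theorems.SymmetryModuliCountAxisymEndLiouvilleStubAxisNormalForm
import Summits.NavierStokesRegularity.NavierStokesRegularity.Theorems.SymmetryModuliCountFarPastLedgerCovering
import Summits.NavierStokesRegularity.NavierStokesRegularity.Theorems.SymmetryModuliCountFarPastLedgerFarShell
import Summits.NavierStokesRegularity.NavierStokesRegularity.Theorems.SymmetryModuliCountFarPastLedgerPressureGradientBound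
import Summits.NavierStokesRegularity.NavierStokesRegularity.Theorems.SymmetryModuliCountFarPastLedgerPinning
import Summits.NavierStokesRegularity.NavierStokesRegularity.Theorems.SymmetryModuliCountFarPastLedgerMeanDisplacement

/-!
# `AxisymEndLiouvilleOfFarPastLedger` (stmt-NavierStokesRegularity-14736), 𝒦-route: reduction to
# the slice-pressure lemma

Route SymmetryModuliCount, item `AxisymEndLiouvilleOfFarPastLedger := FarPastLedger → AxisymEndLiouville`.

`axisymEndLiouvilleOfFarPastLedger_of_slicePressure`: the item follows from the single remaining
analytic input HA — the slice harmonic analysis of the Oseen pressure (verbatim the statement of the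
registered stub `stub_fplSlicePressure` of the crux `FarPastLedger`, stmt-NavierStokesRegularity-14060,
line `uloc-gronwall-transplant`): every smooth `q` with `Δq = −div((w·∇)w)`, `‖∇q‖ ≤ L`, `w` smooth,
bounded by `M` and divergence free, has on every ball `B₂(x₀)` the near/far structure
`q = c + ⟪a,·⟫ + p₁ + p₂` with `‖p₁‖₂² ≤ c₀M²∫_{B₄(x₀)}‖w‖²`, `‖∇p₂‖ ≤ c₀∫_{|y−x₀|≥3}‖w‖²|y−x₀|⁻⁴`
and the affine coefficient `a` equal to the large-scale bump average of `∇q` up to `c₀M²/r`.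

Everything else is instantiated BY NAME from landed tree theorems:
the composition `farPastLedger_imp_axisymEndLiouville_of_parts` and the near/far window lemma
`nearFar_window_of_parts` (`…OfFarPastLedgerAssembly`), the pressure package
`pressurePackage_of_nearFar` (`…Pressure`), the cubic bound `lintegral_parabolicCylinder_le`
(`…Cubic`), the blow-down driver `exists_singular_axisymmetric_limit` (`…Driver`), the endgame
`false_of_axisymmetric_typeI_singular` (`…Endgame`, Seregin–Šverák 2009 Thm 3.1), the axis normal
form `stub_axisNormalForm` (crux `AxisymEndLiouville`, line `absorbing-axis-swirl-extinction`), and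
the crux `FarPastLedger`'s landed stubs `stub_fplCovering`, `stub_fplFarShell`,
`stub_fplPressureGradientBound`, `stub_fplPinning`, `stub_fplMeanDisplacement`.
-/

noncomputable section

-- the summit and its single problem share the name (D-0017 nested layout)
set_option linter.dupNamespace false

open MeasureTheory Set Metric Filter Function TopologicalSpace
open scoped ENNReal NNReal Topology

namespace Summit.NavierStokesRegularity.NavierStokesRegularity.Theorems.AxisymEndLiouvilleOfFarPastLedger

open Literature.Analysis.FluidPDE
open Summit.NavierStokesRegularity.NavierStokesRegularity.Theses.SymmetryModuliCount
open Summit.NavierStokesRegularity.NavierStokesRegularity.Theorems.AxisymEndLiouville.AbsorbingAxisSwirlExtinction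
  (stub_axisNormalForm)

/-- **Reduction of `AxisymEndLiouvilleOfFarPastLedger` to the slice-pressure lemma HA.** If the
slice harmonic analysis of the Oseen pressure holds (hypothesis `hHA`, verbatim the registered stub
`stub_fplSlicePressure` of the crux `FarPastLedger`), then `FarPastLedger → AxisymEndLiouville`:
HA with GRADP/PIN/MD gives the near/far structure of the window pressure of every `w ∈ A_C`
(`nearFar_window_of_parts`), the far-shell lemma (SHELL fed with COV) and the pressure package put the
ledger class in Albritton–Barker's `𝒦` uniformly, and the composition
`farPastLedger_imp_axisymEndLiouville_of_parts` (normal form ⇒ blow-down driver ⇒ Seregin–Šverák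
endgame) concludes. [cite: SereginSverak2009, Thm 3.1 (= Thm 1.1); AlbrittonBarker2019, §2–3] -/
theorem axisymEndLiouvilleOfFarPastLedger_of_slicePressure
    (hHA : ∃ c₀ : ℝ, 0 ≤ c₀ ∧ ∀ (M L : ℝ) (w : EuclideanSpace ℝ (Fin 3) → EuclideanSpace ℝ (Fin 3))
      (q : EuclideanSpace ℝ (Fin 3) → ℝ), ContDiff ℝ (⊤ : ℕ∞) w → ContDiff ℝ (⊤ : ℕ∞) q →
      Literature.Analysis.FluidPDE.VectorCalculus.IsDivFree w → (∀ x, ‖w x‖ ≤ M) →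
      (∀ x, ‖fderiv ℝ q x‖ ≤ L) →
      (∀ x, Laplacian.laplacian q x =
        -Literature.Analysis.FluidPDE.VectorCalculus.divergence (Literature.Analysis.FluidPDE.convect w w) x) →
      ∃ a : EuclideanSpace ℝ (Fin 3), (∀ x₀ : EuclideanSpace ℝ (Fin 3), ∃ (c : ℝ)
        (p₁ p₂ : EuclideanSpace ℝ (Fin 3) → ℝ), (∀ x ∈ Metric.ball x₀ 2, q x = c + inner ℝ a x + p₁ x + p₂ x) ∧
        MeasureTheory.MemLp p₁ 2 MeasureTheory.volume ∧
        ∫ x, p₁ x ^ 2 ≤ c₀ * M ^ 2 * ∫ x in Metric.ball x₀ 4, ‖w x‖ ^ 2 ∧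
        ∀ x ∈ Metric.ball x₀ 2, DifferentiableAt ℝ p₂ x ∧
          ‖fderiv ℝ p₂ x‖ ≤ c₀ * ∫ y in (Metric.ball x₀ 3)ᶜ, ‖w y‖ ^ 2 / ‖y - x₀‖ ^ 4) ∧
        ∀ r : ℝ, 1 ≤ r → ‖(∫ x, ((⟨1, 2, zero_lt_one, one_lt_two⟩ :
          ContDiffBump (0 : EuclideanSpace ℝ (Fin 3))) : EuclideanSpace ℝ (Fin 3) → ℝ) (r⁻¹ • x))⁻¹ •
          (∫ x, (((⟨1, 2, zero_lt_one, one_lt_two⟩ : ContDiffBump (0 : EuclideanSpace ℝ (Fin 3))) :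
            EuclideanSpace ℝ (Fin 3) → ℝ) (r⁻¹ • x)) • gradient q x) - a‖ ≤ c₀ * M ^ 2 / r) :
    AxisymEndLiouvilleOfFarPastLedger := by
  obtain ⟨c₀, hc₀, hHA⟩ := hHA
  obtain ⟨cS, hcS0, hS⟩ := stub_fplFarShell
  refine farPastLedger_imp_axisymEndLiouville_of_parts (c₀ := c₀) ⟨cS, hcS0, hS stub_fplCovering⟩
    (fun C w hw => ?_) (fun C K cS' hcS' hS' hNF => pressurePackage_of_nearFar (K := K) hc₀ hcS' hS' hNF)
    (fun C K w hw hK => ?_)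
    (fun C K D₀ hcubic hPress v hv hKv hax t₀ ht₀ x₀ hne =>
      exists_singular_axisymmetric_limit hcubic hPress hv hKv hax ht₀ hne)
    (fun hR hball hL3 hsym htypeI hsing =>
      false_of_axisymmetric_typeI_singular hR hball hL3 hsym htypeI hsing)
    stub_axisNormalForm
  · -- the near/far structure of the window pressure on `(-3, 0)` at the centre `0`
    obtain ⟨p, hp, h⟩ := nearFar_window_of_parts hc₀ stub_fplPressureGradientBound hHA stub_fplPinning
      stub_fplMeanDisplacement hw (t₀ := (-3 : ℝ)) (by norm_num)
    exact ⟨p, hp, fun τ hτ => h τ hτ 0⟩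
  · -- the cubic bound on the unit parabolic ball
    have key := lintegral_parabolicCylinder_le hw hK (z := (0 : ℝ × EuclideanSpace ℝ (Fin 3))) le_rfl one_pos
    simpa using key

end Summit.NavierStokesRegularity.NavierStokesRegularity.Theorems.AxisymEndLiouvilleOfFarPastLedger

end
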